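import Mathlib
import Literature.Computability.Complexity.RangeAvoidance
import Literature.Computability.Complexity.SignDegreeXor
import HarnessLib.Audit
import Summits.PneNP.PneNP.Theorems.PstarSA2Blind
import Summits.PneNP.PneNP.Theorems.PairwiseSALevel

/-!
# ROUND-22 headlines: SA blindness for pure-`IP₃` avoidance, and SA blindness AFTER the XOR quotient of `P⋆` (cell `pnp-ideate`)

FRONTIER range-avoidance ladder, rung F-N3 context (restricted-model lower bounds for the Sherali–Adams hierarchy — nothing
here bears on `P` vs `NP`).

The ROUND-21 headline `PstarSALinearBlind.saLinearBlind` (linear-level SA cannot separate range from non-range points of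
pure-`P⋆` maps at any linear stretch) is GRIGORIEV-TYPE (memo §11): its expanding instances include families solvable in `FP` by
Gaussian elimination (`PstarLinearisation`), because Sherali–Adams cannot quotient out the `𝔽₂`-linear XOR layer.  The
hardness-relevant successor asks whether SA stays blind AFTER that layer is eliminated exactly.  For a typed instance
(`Range = Cut(G_L) ⊕ Clique(G_A)`, `PstarTyped.mem_range_typed_iff`; cycle form `PstarTypedCycle.not_mem_range_typed_iff_cycle`)
with `G_L` a disjoint union of cliques `K_t`, the cycle space is spanned by triangles and the exact quotient of the avoidance problem
is avoidance for a `6`-local map with the pure degree-`2` predicate `IP₃(u) = u₀u₁ ⊕ u₂u₃ ⊕ u₄u₅` (`ipPred 3`) on the AND variables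
(memo §8b(3), family `H′(t)`).  This file types:

* `IP3PairwiseLaws` (target T22.1a(i)): every pure-`IP₃` system `Φ(s) = b` carries `PairwiseSALevel.PairwiseLaws` (biases `1/√2`;
  law = biased product conditioned on the fibre; any two of the three AND-bits are independent uniform);
* `ExpandingIP3Exist` (target T22.2-A): at every stretch, `(n/c, 7/2)`-boundary-expanding pure-`IP₃` instances exist (first moment;
  random `6`-uniform hypergraphs reach every ratio `< 4`);
* `IP3SALinearBlind` (COR-A) and its wiring `ip3SALinearBlind_of : PairwiseSALinearLevel → IP3PairwiseLaws → ExpandingIP3Exist → …`: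
  pure-`IP₃` range avoidance (`NC⁰₆`, a predicate with NO linear part) is linear-level SA-blind at every constant stretch;
* `SAAfterQuotientBlind` (HEADLINE-22): at every stretch `C` there are pure-`P⋆` instances with a non-range point whose avoidance
  problem has an EXACT XOR-LINEAR QUOTIENT (`π` linear, onto, `y ∈ Range I ↔ π y ∈ Range Φ`) that is a pure-`IP₃` `6`-local map `Φ` on
  at most `n` variables with `β ≥ m − n` outputs, and `Φ` is SA-feasible for EVERY target at level `n / c`.  The level is linear in the
  ORIGINAL `n` (so a degenerate quotient on `O(1)` variables cannot witness it: SA at level `≥ #variables` is exact,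
  `PstarSALevel.mem_range_of_saFeasible`); `saAfterQuotientBlind_ip3 : SAAfterQuotientBlind → IP3SALinearBlind` records that the
  headline is at least the pure-`IP₃` statement.  Route to it (memo r22): `PairwiseSALinearLevel` on the `K_t`-BLOCK system
  (arity `t(t-1)`; block law pairwise independent since `Cycle(K_t)` has minimum distance `3`) + the threshold-`3` support clause
  (a triangle inside `S` puts `6 ≥ 3` block variables in `S`) + block-hypergraph expansion by first moment + the per-block cycle bridge.
-/

set_option linter.dupNamespace false

open Finset
open Literature.Computability.Complexity
open Summit.PneNP.PneNP.Theorems.PstarSA2Blind (exists_not_mem_range)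
open Summit.PneNP.PneNP.Theorems.PstarSALevel (SAFeasible mem_range_of_saFeasible)
open Summit.PneNP.PneNP.Theorems.PstarSASDPLevel (BoundaryExpandingQ)
open Summit.PneNP.PneNP.Theorems.PairwiseSALevel (PairwiseLaws SAFeasibleAt PairwiseSALinearLevel)

namespace Summit.PneNP.PneNP.Theorems.QuotientSAHeadline

/-! ### Pure `IP₃` (COR-A) -/

/-- **T22.1a(i) (target).**  Every pure-`IP₃` system `Φ(s) = b` carries pairwise-independent fibre laws with variable-consistent
biases (all biases `1/√2`: the biased product law on the six slots conditioned on `u₀u₁ ⊕ u₂u₃ ⊕ u₄u₅ = b j`). -/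
@[conjecture] def IP3PairwiseLaws : Prop :=
  ∀ (n m : ℕ) (I : LocalMap 6 n m), I.IsPure (ipPred 3) → ∀ y : Fin m → Bool,
    ∃ (p : Fin n → ℝ) (μ : Fin m → (Fin 6 → Bool) → ℝ), PairwiseLaws I y p μ

/-- **T22.2-A (target).**  At every stretch `C` there is `c > 0` such that for infinitely many `n` some pure-`IP₃` instance with
`n < m` and `C·n ≤ m` outputs is `(n / c, 7/2)`-boundary expanding. -/
@[conjecture] def ExpandingIP3Exist : Prop :=
  ∀ C : ℕ, ∃ c : ℕ, 0 < c ∧ ∀ N : ℕ, ∃ n, N ≤ n ∧ ∃ m, n < m ∧ C * n ≤ m ∧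
    ∃ I : LocalMap 6 n m, I.IsPure (ipPred 3) ∧ BoundaryExpandingQ 7 2 (n / c) I

/-- **COR-A.**  Pure-`IP₃` range avoidance is linear-level Sherali–Adams blind at every constant stretch: for every `C` there is
`c > 0` such that for infinitely many `n` some pure-`IP₃` `6`-local map with `C·n ≤ m` outputs has a point outside its range while
level-`n / c` Sherali–Adams is feasible for EVERY target. -/
def IP3SALinearBlind : Prop :=
  ∀ C : ℕ, ∃ c : ℕ, 0 < c ∧ ∀ N : ℕ, ∃ n, N ≤ n ∧ ∃ m, C * n ≤ m ∧
    ∃ I : LocalMap 6 n m, I.IsPure (ipPred 3) ∧ (∃ y, y ∉ I.range) ∧ ∀ y, SAFeasible (n / c) I y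

/-- **COR-A by name** from the hub, the `IP₃` laws and the existence of expanding instances. -/
theorem ip3SALinearBlind_of (h0 : PairwiseSALinearLevel) (h1 : IP3PairwiseLaws) (h2 : ExpandingIP3Exist) :
    IP3SALinearBlind := by
  obtain ⟨c₀, hc₀, H⟩ := h0 6 7 2 (by norm_num) (by norm_num)
  intro C
  obtain ⟨c₁, hc₁, hE⟩ := h2 C
  refine ⟨c₁ * c₀, Nat.mul_pos hc₁ hc₀, fun N => ?_⟩
  obtain ⟨n, hNn, m, hnm, hCm, I, hP, hB⟩ := hE N
  refine ⟨n, hNn, m, hCm, I, hP, exists_not_mem_range I hnm, fun y => ?_⟩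
  obtain ⟨p, μ, hL⟩ := h1 n m I hP y
  have hinj : ∀ j, Function.Injective (I.vars j) := fun j => hP.2 j
  have h := (H n m (n / c₁) I y p μ hinj hL hB).saFeasible_of_injective hinj (by norm_num)
  rwa [Nat.div_div_eq_div_mul] at h

/-! ### After the XOR quotient of `P⋆` (HEADLINE-22) -/

/-- A map between Boolean vectors is XOR-linear (`𝔽₂`-linear). -/
def IsXorLinear {m β : ℕ} (π : (Fin m → Bool) → (Fin β → Bool)) : Prop :=
  ∀ y y' : Fin m → Bool, π (fun j => xor (y j) (y' j)) = fun i => xor (π y i) (π y' i)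

/-- **HEADLINE-22 (target of ROUND-22).**  At every stretch `C` there is `c > 0` such that for infinitely many `n` some
pure-`P⋆` instance `I` with `C·n ≤ m` outputs has a point outside its range, and its avoidance problem has an exact XOR-linear
quotient — an XOR-linear surjection `π` with `y ∈ Range I ↔ π y ∈ Range Φ` onto the targets of a pure-`IP₃` `6`-local map `Φ` on at
most `n` variables with at least `m − n` outputs — such that `Φ` is Sherali–Adams feasible at level `n / c` for EVERY target: linear-
level SA is blind on `P⋆` avoidance even after exact elimination of the XOR layer. -/
def SAAfterQuotientBlind : Prop :=
  ∀ C : ℕ, ∃ c : ℕ, 0 < c ∧ ∀ N : ℕ, ∃ n, N ≤ n ∧ ∃ m, C * n ≤ m ∧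
    ∃ I : LocalMap 4 n m, I.IsPure xorAndPred ∧ (∃ y, y ∉ I.range) ∧
    ∃ (n' β : ℕ) (Φ : LocalMap 6 n' β) (π : (Fin m → Bool) → (Fin β → Bool)),
      n' ≤ n ∧ m ≤ β + n ∧ Φ.IsPure (ipPred 3) ∧ IsXorLinear π ∧ Function.Surjective π ∧
      (∀ y, y ∈ I.range ↔ π y ∈ Φ.range) ∧ ∀ b, SAFeasible (n / c) Φ b

/-- **The headline is at least COR-A**: its quotients are themselves pure-`IP₃` maps, of stretch `≥ C − 1` in their own variable
count `n'`, with a non-range point, SA-feasible for every target at a level linear in `n'` — and `n'` is unbounded because SA at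
level `≥ n'` is exact. -/
theorem saAfterQuotientBlind_ip3 (h : SAAfterQuotientBlind) : IP3SALinearBlind := by
  intro C
  obtain ⟨c, hc, hE⟩ := h (C + 1)
  refine ⟨c, hc, fun N => ?_⟩
  obtain ⟨n, hNn, m, hCm, I, hP, ⟨y₀, hy₀⟩, n', β, Φ, π, hn', hβ, hΦ, -, -, hrange, hSA⟩ := hE (c * N)
  -- `π y₀` is outside the range of `Φ`, so level `n / c` is below `n'`
  have hb₀ : π y₀ ∉ Φ.range := fun hb => hy₀ ((hrange y₀).2 hb)
  have hlt : n / c < n' := by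
    by_contra hle
    exact hb₀ (mem_range_of_saFeasible Φ (hSA (π y₀)) (not_lt.1 hle))
  refine ⟨n', ?_, β, ?_, Φ, hΦ, ⟨π y₀, hb₀⟩, fun b => (hSA b).anti (Nat.div_le_div_right hn')⟩
  · -- `N ≤ (c N) / c ≤ n / c < n'`
    have : N ≤ n / c := by
      calc N = c * N / c := (Nat.mul_div_cancel_left N hc).symm
        _ ≤ n / c := Nat.div_le_div_right hNn
    omega
  · -- `C n' ≤ C n ≤ m - n ≤ β`
    have h1 : C * n' ≤ C * n := Nat.mul_le_mul_left C hn'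
    have h2 : (C + 1) * n = C * n + n := by ring
    omega

end Summit.PneNP.PneNP.Theorems.QuotientSAHeadline
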